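import Literature.Computability.Cryptography.CubicClassPost
import Literature.Computability.Cryptography.ConvergentNumeratorsFP
import Literature.Computability.Complexity.CodeFPRat
import Literature.Computability.Complexity.CodeFPInvFolds
import HarnessLib

/-!
# The class-group post-processor on codes, I: bounded-denominator rounding by continued fractions

Topic `Computability/Cryptography`; theorem-only companion of `CubicClassPost.lean` (the classical post-processor of the
class-group stage of the crux `LinnikCubicClassGroups.PureCubicClassGroupFBQP`, line `arakelov-giant-step-cycle`). Its
rounding `roundB B x` — THE fraction of denominator `≤ B` within `1/(2B²)` of `x`, else `0` — is specified by
`Classical.choose`; this file proves it is computed on codes by the continued-fraction scan of the tree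
(`OFPostCF.quots`/`evalFrac`, `PeriodFinding.convRun`):

* `abs_sub_ge_of_ne`, `roundB_unique` — two fractions of denominators `≤ B` closer than `1/B²` coincide (so the choice
  in `roundB` is forced);
* `roundB_eq_scan` — for `x = A/D` (`D > 0`), `roundB B x` is the first convergent `p_k/q_k`, `k ≤ 2 size D`, passing the
  integer test `q_k ≤ B ∧ 2B² |A q_k − p_k D| < D q_k`, else `0` (completeness by Legendre's theorem, Mathlib's
  `Real.exists_rat_eq_convergent`: a fraction within `1/(2B²) ≤ 1/(2 den²)` is a convergent, and every convergent of `A/D`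
  occurs among the first `2 size D + 1`, `OFPostCF.natConv_eq_of_le`);
* `codeFP_convPair`, `codeFP_roundBScan`, `codeFP_roundB_fract` — the scan, hence `(B, x) ↦ roundB B (fract x)`, is computed
  on codes (`CodeFP`).

## References

* A. Yu. Kitaev, arXiv:quant-ph/9511026 (1995), §4. [Kitaev1995]
* G. H. Hardy, E. M. Wright, *An Introduction to the Theory of Numbers*, 6th ed. 2008, §10.15 Thm. 184. [HardyWright2008]
* S. Arora, B. Barak, *Computational Complexity: A Modern Approach*, CUP 2009, §1.3. [AroraBarak2009]
-/

noncomputable section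

namespace Literature.Computability.Cryptography

namespace CubicClassPost

open Literature.Computability.Complexity Literature.Computability.Complexity.CodeFP Polynomial
open Literature.Algebra.EuclideanLattices (encodeRat)
open OFPostCF OFPostB PeriodFinding

/-! ### Uniqueness of the bounded-denominator approximation -/

/-- Distinct fractions are at least `1/(den · den')` apart. [cite: HardyWright2008, §10.15] -/
theorem abs_sub_ge_of_ne {r r' : ℚ} (h : r ≠ r') : 1 / ((r.den : ℚ) * r'.den) ≤ |r - r'| := by
  have hd : (0 : ℚ) < r.den := by exact_mod_cast r.den_pos
  have hd' : (0 : ℚ) < r'.den := by exact_mod_cast r'.den_pos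
  have key : r - r' = ((r.num * r'.den - r'.num * r.den : ℤ) : ℚ) / ((r.den : ℚ) * r'.den) := by
    rw [eq_div_iff (mul_pos hd hd').ne']
    push_cast
    rw [← Rat.mul_den_eq_num r, ← Rat.mul_den_eq_num r']
    ring
  have hne : (r.num * r'.den - r'.num * r.den : ℤ) ≠ 0 := by
    intro h0
    apply h
    have : r - r' = 0 := by rw [key, h0]; simp
    linarith
  rw [key, abs_div, abs_of_pos (mul_pos hd hd'), div_le_div_iff_of_pos_right (mul_pos hd hd')]
  exact_mod_cast Int.one_le_abs hne

/-- **Two fractions of denominators `≤ B` within `1/(2B²)` of the same number coincide.** [cite: Kitaev1995, §4] -/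
theorem roundB_unique {B : ℕ} {x r r' : ℚ} (hr : r.den ≤ B ∧ |x - r| < 1 / (2 * (B : ℚ) ^ 2))
    (hr' : r'.den ≤ B ∧ |x - r'| < 1 / (2 * (B : ℚ) ^ 2)) : r = r' := by
  by_contra hne
  have hB : (0 : ℚ) < B := by
    have : 1 ≤ B := le_trans r.den_pos hr.1
    exact_mod_cast this
  have h1 := abs_sub_ge_of_ne hne
  have h2 : |r - r'| < 1 / (B : ℚ) ^ 2 := by
    have := abs_sub_abs_le_abs_sub (x - r') (x - r)
    calc |r - r'| = |(x - r') - (x - r)| := by ring_nf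
      _ ≤ |x - r'| + |x - r| := abs_sub _ _
      _ < 1 / (2 * (B : ℚ) ^ 2) + 1 / (2 * (B : ℚ) ^ 2) := add_lt_add hr'.2 hr.2
      _ = 1 / (B : ℚ) ^ 2 := by ring
  have h3 : 1 / (B : ℚ) ^ 2 ≤ 1 / ((r.den : ℚ) * r'.den) := by
    apply one_div_le_one_div_of_le (by have := r.den_pos; have := r'.den_pos; positivity)
    have ha : (r.den : ℚ) ≤ B := by exact_mod_cast hr.1
    have hb : (r'.den : ℚ) ≤ B := by exact_mod_cast hr'.1
    have : (0 : ℚ) ≤ r.den := by positivity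
    nlinarith
  linarith

/-! ### The rounding by the continued-fraction scan -/

/-- The integer test of the scan is the defining inequality of `roundB` (for a convergent `p/q'` of `A/D`, `D, q' > 0`).
[folklore] -/
theorem scanTest_iff {A D B p q' : ℕ} (hD : 0 < D) (hq : 0 < q') :
    (q' ≤ B ∧ 2 * B ^ 2 * ((A : ℤ) * q' - p * D).natAbs < D * q') ↔
      (q' ≤ B ∧ |(A : ℚ) / D - (p : ℚ) / q'| < 1 / (2 * (B : ℚ) ^ 2)) := by
  rcases Nat.eq_zero_or_pos B with rfl | hB
  · constructor <;> rintro ⟨h, -⟩ <;> omega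
  refine and_congr_right fun _ => ?_
  have hDq : (0 : ℚ) < D := by exact_mod_cast hD
  have hqq : (0 : ℚ) < q' := by exact_mod_cast hq
  have hBq : (0 : ℚ) < B := by exact_mod_cast hB
  have e : (A : ℚ) / D - (p : ℚ) / q' = (((A : ℤ) * q' - p * D : ℤ) : ℚ) / ((D : ℚ) * q') := by
    rw [div_sub_div _ _ hDq.ne' hqq.ne']
    push_cast; ring
  rw [e, abs_div, abs_of_pos (mul_pos hDq hqq), div_lt_div_iff₀ (mul_pos hDq hqq) (by positivity), one_mul,
    ← Nat.cast_lt (α := ℚ)]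
  push_cast
  rw [natCast_natAbs]
  push_cast
  constructor <;> intro h <;> linarith [h]

/-- **`roundB` is computed by the continued-fraction scan**: for `D > 0`, `roundB B (A/D)` is the first convergent
`p_k/q_k` (`k ≤ 2 size D`) passing `q_k ≤ B ∧ 2B²|A q_k − p_k D| < D q_k`, else `0`. Completeness: a fraction of denominator
`den ≤ B` within `1/(2B²) ≤ 1/(2 den²)` is a convergent (Legendre), and the convergents of `A/D` all occur among the first
`2 size D + 1`. [cite: Kitaev1995, §4; HardyWright2008, §10.15 Thm. 184] -/
theorem roundB_eq_scan (A B : ℕ) {D : ℕ} (hD : 0 < D) :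
    roundB B ((A : ℚ) / D) =
      (((List.range (2 * D.size + 1)).map fun k => evalFrac (quots A D (k + 1))).find?
        (fun pq => decide (pq.2 ≤ B ∧ 2 * B ^ 2 * ((A : ℤ) * pq.2 - pq.1 * D).natAbs < D * pq.2))).elim 0
        (fun pq => (pq.1 : ℚ) / pq.2) := by
  classical
  -- a convergent in lowest terms: its denominator
  have hden : ∀ k, (((evalFrac (quots A D (k + 1))).1 : ℚ) / (evalFrac (quots A D (k + 1))).2).den =
      (evalFrac (quots A D (k + 1))).2 := by
    intro k
    have h := Rat.den_div_eq_of_coprime (a := (evalFrac (quots A D (k + 1))).1) (b := (evalFrac (quots A D (k + 1))).2)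
      (by exact_mod_cast evalFrac_quots_snd_pos hD A k) (by simpa using evalFrac_coprime (quots A D (k + 1)))
    push_cast at h
    exact_mod_cast h
  rcases em (((List.range (2 * D.size + 1)).map fun k => evalFrac (quots A D (k + 1))).find?
      (fun pq => decide (pq.2 ≤ B ∧ 2 * B ^ 2 * ((A : ℤ) * pq.2 - pq.1 * D).natAbs < D * pq.2)) = none) with hf | hf'
  · -- no convergent passes: there is no candidate
    rw [hf, roundB, dif_neg]
    · rfl
    rintro ⟨r, hrB, hr⟩
    have hB1 : 1 ≤ B := le_trans r.den_pos hrB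
    -- Legendre: `r` is a convergent of `A/D`
    have hleg : |((A : ℝ) / D) - r| < 1 / (2 * (r.den : ℝ) ^ 2) := by
      have h1 : |((A : ℚ) / D) - r| < 1 / (2 * (r.den : ℚ) ^ 2) := by
        refine lt_of_lt_of_le hr (one_div_le_one_div_of_le (by have := r.den_pos; positivity) ?_)
        have : (r.den : ℚ) ≤ B := by exact_mod_cast hrB
        have : (0 : ℚ) ≤ r.den := by positivity
        nlinarith
      have h2 : (((|((A : ℚ) / D) - r| : ℚ)) : ℝ) < ((1 / (2 * (r.den : ℚ) ^ 2) : ℚ) : ℝ) := by exact_mod_cast h1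
      push_cast at h2
      exact h2
    obtain ⟨n, hn⟩ := Real.exists_rat_eq_convergent hleg
    set k := min n (2 * D.size) with hk
    have hrk : r = natConv A D k := by
      have e1 : (r : ℝ) = natConv A D n := by rw [hn, natConv_eq_convergent hD]
      have e2 : natConv A D n = natConv A D k := by
        by_cases hns : n ≤ 2 * D.size
        · rw [hk, min_eq_left hns]
        · rw [hk, min_eq_right (by omega)]
          exact natConv_eq_of_le hD (Nat.lt_size_self D) (by omega)
      exact_mod_cast e1.trans (congrArg _ e2)
    rw [natConv_eq_evalFrac hD] at hrk
    have hq0 := evalFrac_quots_snd_pos hD A k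
    -- it is listed and passes the test: contradiction
    have hmem : evalFrac (quots A D (k + 1)) ∈ (List.range (2 * D.size + 1)).map fun k => evalFrac (quots A D (k + 1)) :=
      List.mem_map.2 ⟨k, List.mem_range.2 (by omega), rfl⟩
    refine (List.find?_eq_none.1 hf) _ hmem ?_
    rw [decide_eq_true_eq, scanTest_iff hD hq0]
    refine ⟨?_, by rw [← hrk]; exact hr⟩
    rw [← hden k, ← hrk]; exact hrB
  · -- some convergent passes: it is the candidate
    obtain ⟨pq, hf⟩ := Option.ne_none_iff_exists'.1 hf'
    have hpass := List.find?_some hf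
    obtain ⟨k, -, rfl⟩ := List.mem_map.1 (List.mem_of_find?_eq_some hf)
    rw [decide_eq_true_eq, scanTest_iff hD (evalFrac_quots_snd_pos hD A k)] at hpass
    have hr : (((evalFrac (quots A D (k + 1))).1 : ℚ) / (evalFrac (quots A D (k + 1))).2).den ≤ B ∧
        |(A : ℚ) / D - ((evalFrac (quots A D (k + 1))).1 : ℚ) / (evalFrac (quots A D (k + 1))).2| < 1 / (2 * (B : ℚ) ^ 2) :=
      ⟨by rw [hden k]; exact hpass.1, hpass.2⟩
    have hex : ∃ r : ℚ, r.den ≤ B ∧ |(A : ℚ) / D - r| < 1 / (2 * (B : ℚ) ^ 2) := ⟨_, hr⟩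
    rw [hf, roundB, dif_pos hex]
    exact roundB_unique (Classical.choose_spec hex) hr

/-! ### The scan on codes -/

/-- **The `k`-th convergent pair of `A/D` is computed on codes**: `(A, D, 1^f) ↦ evalFrac (quots A D f)` (Euclid with the
forward recurrence, `PeriodFinding.convRun`, iterated `f` times; accumulator bound `length_cstE_le`). [cite: AroraBarak2009, §1.3] -/
theorem codeFP_convPair : CodeFP (pairE natE (pairE natE unE)) (pairE natE natE) (fun c => evalFrac (quots c.1 c.2.1 c.2.2)) := by
  have hF : CodeFP (pairE (pairE natE (pairE natE unE)) cstE) cstE (fun t => convStep t.2) := codeFP_convStep.comp (snd _ _)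
  have hinit : CodeFP (pairE natE (pairE natE unE)) cstE (fun c => ((c.1, c.2.1), ((1 : ℕ), (0 : ℕ), (0 : ℕ), (1 : ℕ)), ([] : List ℕ))) :=
    (((fst _ _).pair (snd _ _).fst').pair ((const _ ((1 : ℕ), (0 : ℕ), (0 : ℕ), (1 : ℕ))).pair (const _ ([] : List ℕ))) :)
  have h := iterateInv (eσ := pairE natE (pairE natE unE)) (eβ := cstE) (F := fun _ st => convStep st)
    (init := fun c => ((c.1, c.2.1), (1, 0, 0, 1), [])) (k := fun c => c.2.2)
    (fun c j st => st = convRun c.1 c.2.1 j) hF hinit (snd _ _).snd' (fun c => rfl)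
    (fun c j st hst => by rw [hst, convRun, convRun, Function.iterate_succ_apply'])
    ((2 * X + 20) * (X + 4))
    (fun c j st hst => by
      rw [hst]
      refine (length_cstE_le c.1 c.2.1 j).trans ?_
      simp only [eval_mul, eval_add, eval_ofNat, eval_X]
      have h1 : (natE c.1).length + (natE c.2.1).length ≤ (pairE natE (pairE natE unE) c).length := by
        rw [length_pairE, length_pairE]; omega
      exact Nat.mul_le_mul (by omega) (by omega))
  have h2 : CodeFP (pairE natE (pairE natE unE)) (pairE natE natE) (fun c => ((convRun c.1 c.2.1 c.2.2).2.1.1, (convRun c.1 c.2.1 c.2.2).2.1.2.1)) :=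
    h.snd'.fst'.fst'.pair h.snd'.fst'.snd'.fst'
  refine h2.congr fun c => ?_
  rw [convRun_spec]
  exact cfFwd_eq_evalFrac _

/-- **The rounding scan is computed on codes**: `(B, A, D) ↦` the first listed convergent of `A/D` passing the integer
test, as a fraction, else `0`. [cite: AroraBarak2009, §1.3] -/
theorem codeFP_roundBScan : CodeFP (pairE natE (pairE natE natE)) encodeRat (fun w =>
    (((List.range (2 * w.2.2.size + 1)).map fun k => evalFrac (quots w.2.1 w.2.2 (k + 1))).find?
      (fun pq => decide (pq.2 ≤ w.1 ∧ 2 * w.1 ^ 2 * ((w.2.1 : ℤ) * pq.2 - pq.1 * w.2.2).natAbs < w.2.2 * pq.2))).elim 0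
      (fun pq => (pq.1 : ℚ) / pq.2)) := by
  have hB : CodeFP (pairE natE (pairE natE natE)) natE (fun w => w.1) := fst _ _
  have hA : CodeFP (pairE natE (pairE natE natE)) natE (fun w => w.2.1) := (snd _ _).fst'
  have hD : CodeFP (pairE natE (pairE natE natE)) natE (fun w => w.2.2) := (snd _ _).snd'
  -- the fuel `2 size D + 1` in unary
  have hf : CodeFP (pairE natE (pairE natE natE)) unE (fun w => 2 * w.2.2.size + 1) :=
    (unSucc.comp ((unMulConst 2).comp (strLength.comp (strOfNat.comp hD)))).congr fun w => by simp [length_natE]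
  -- the list of convergent pairs: item `k` (binary) read with fuel `min (k + 1) (2 size D + 1)`
  have hk : CodeFP (pairE (pairE natE (pairE natE natE)) natE) unE (fun q => min (q.2 + 1) (2 * q.1.2.2.size + 1)) :=
    (unOfNatMin.comp ((hf.comp (fst _ _)).pair (natAdd.comp ((snd _ _).pair (const _ (1 : ℕ))))) :)
  have hitem : CodeFP (pairE (pairE natE (pairE natE natE)) natE) (pairE natE natE)
      (fun q => evalFrac (quots q.1.2.1 q.1.2.2 (min (q.2 + 1) (2 * q.1.2.2.size + 1)))) :=
    (codeFP_convPair.comp ((hA.comp (fst _ _)).pair ((hD.comp (fst _ _)).pair hk)) :)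
  have hL : CodeFP (pairE natE (pairE natE natE)) (rawE (pairE natE natE))
      (fun w => (List.range (2 * w.2.2.size + 1)).map fun k => evalFrac (quots w.2.1 w.2.2 (k + 1))) := by
    refine ((map hitem).comp ((CodeFP.id _).pair (urange.comp hf))).congr fun w => ?_
    dsimp only [CodeFP.id, id]
    refine List.map_congr_left fun k hk => ?_
    rw [min_eq_left (by have := List.mem_range.1 hk; omega)]
  -- the test, context `w`
  have tB : CodeFP (pairE (pairE natE (pairE natE natE)) (pairE natE natE)) natE (fun q => q.1.1) := (fst _ _).fst'
  have tA : CodeFP (pairE (pairE natE (pairE natE natE)) (pairE natE natE)) intE (fun q => (q.1.2.1 : ℤ)) := intOfNat.comp (fst _ _).snd'.fst'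
  have tD : CodeFP (pairE (pairE natE (pairE natE natE)) (pairE natE natE)) natE (fun q => q.1.2.2) := (fst _ _).snd'.snd'
  have tp : CodeFP (pairE (pairE natE (pairE natE natE)) (pairE natE natE)) intE (fun q => (q.2.1 : ℤ)) := intOfNat.comp (snd _ _).fst'
  have tq : CodeFP (pairE (pairE natE (pairE natE natE)) (pairE natE natE)) natE (fun q => q.2.2) := (snd _ _).snd'
  have tz : CodeFP (pairE (pairE natE (pairE natE natE)) (pairE natE natE)) natE (fun q => ((q.1.2.1 : ℤ) * q.2.2 - q.2.1 * q.1.2.2).natAbs) :=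
    (intNatAbs.comp (intSub.comp ((intMul.comp (tA.pair (intOfNat.comp tq))).pair (intMul.comp (tp.pair (intOfNat.comp tD))))) :)
  have t1 : CodeFP (pairE (pairE natE (pairE natE natE)) (pairE natE natE)) bitE (fun q => decide (q.2.2 ≤ q.1.1)) := (natLe.comp (tq.pair tB) :)
  have t2 : CodeFP (pairE (pairE natE (pairE natE natE)) (pairE natE natE)) bitE
      (fun q => decide (2 * q.1.1 ^ 2 * ((q.1.2.1 : ℤ) * q.2.2 - q.2.1 * q.1.2.2).natAbs < q.1.2.2 * q.2.2)) :=
    (natLt.comp ((natMul.comp ((natMul.comp ((const _ (2 : ℕ)).pair (natMul.comp (tB.pair tB)))).pair tz)).pair (natMul.comp (tD.pair tq))) :).congr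
      fun q => by rw [sq]
  have ht : CodeFP (pairE (pairE natE (pairE natE natE)) (pairE natE natE)) bitE
      (fun q => decide (q.2.2 ≤ q.1.1 ∧ 2 * q.1.1 ^ 2 * ((q.1.2.1 : ℤ) * q.2.2 - q.2.1 * q.1.2.2).natAbs < q.1.2.2 * q.2.2)) :=
    (t1.and t2).congr fun q => by rw [Bool.decide_and]
  have hfind := (rawFind? ht).comp ((CodeFP.id _).pair hL)
  -- reading the result
  have hout := optCases (σ := ℕ × (ℕ × ℕ)) (eσ := pairE natE (pairE natE natE)) (eα := pairE natE natE) (eδ := encodeRat)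
    (k := fun _ o => o.elim (0 : ℚ) fun pq => (pq.1 : ℚ) / pq.2) (gnone := fun _ => (0 : ℚ))
    (gsome := fun q => (q.2.1 : ℚ) / q.2.2) (const _ (0 : ℚ))
    ((ratOfIntNat.comp (tp.pair tq)).congr fun q => by push_cast; rfl) (fun _ => rfl) (fun _ _ => rfl)
  exact ((hout.comp ((CodeFP.id _).pair hfind)).congr fun w => rfl :)

/-- `fract x = ((num x) mod (den x)) / den x` with a natural numerator. [folklore] -/
theorem fract_eq_div (x : ℚ) : Int.fract x = (((x.num % (x.den : ℤ)).toNat : ℕ) : ℚ) / x.den := by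
  have h0 : 0 ≤ x.num % (x.den : ℤ) := Int.emod_nonneg _ (by exact_mod_cast x.den_pos.ne')
  conv_lhs => rw [← Rat.num_div_den x]
  rw [Int.fract_div_intCast_eq_div_intCast_mod]
  congr 1
  exact_mod_cast (Int.toNat_of_nonneg h0).symm

/-- **The bounded-denominator rounding of a fractional part is computed on codes**: `(B, x) ↦ roundB B (fract x)`.
[cite: Kitaev1995, §4; AroraBarak2009, §1.3] -/
theorem codeFP_roundB_fract : CodeFP (pairE natE encodeRat) encodeRat (fun p => roundB p.1 (Int.fract p.2)) := by
  have hnd : CodeFP (pairE natE encodeRat) (pairE intE natE) (fun p => (p.2.num, p.2.den)) := ratNumDen.comp (snd _ _)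
  have hA : CodeFP (pairE natE encodeRat) natE (fun p => (p.2.num % (p.2.den : ℤ)).toNat) :=
    (intToNat.comp (intEModOf hnd.fst' (intOfNat.comp hnd.snd')) :)
  have h := codeFP_roundBScan.comp ((fst natE encodeRat).pair (hA.pair hnd.snd'))
  refine h.congr fun p => ?_
  dsimp only
  rw [fract_eq_div, roundB_eq_scan _ _ p.2.den_pos]

end CubicClassPost

end Literature.Computability.Cryptography

end
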